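import Literature.NumberTheory.ConnesConsani2021.QuasiInnerPrimeOffDiag
import HarnessLib

/-!
# Connes–Consani 2021 (JNT) §4.3 — the boundary symbol `κκ_p` and the matrix of `(1 − 𝒫)κκ_p𝒫` (bricks)

LINE 1 — LABEL: RH-FREE corpus literature (the product symbol `κκ_p = (ρ_∞ρ_p)∘ψ` on `S¹` as an
`L^∞` function; the matrix of its off-diagonal part in the Fourier basis; the kernel derivatives at `0`
that enter the finite-rank term `ℰ₀`); bears_on: W-C/W-P (P5 sequel vocabulary, no leaf role); WHAT THIS
IS NOT: any claim about RH — nothing in this file bears on the truth of RH.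

Source: A. Connes, C. Consani, *Quasi-inner functions and local factors*, J. Number Theory **226**
(2021) 139–167 = arXiv:2008.10974 [bib: `ConnesConsani2021QuasiInner`], Theorem 4.4 (ii) and its proof
(arXiv chunks p0011:L89–p0012:L18). THEOREMS ONLY; assembly helpers for row t18's named fact
`thm_4_4_ii` (the symbol `toLpOrZero ∞ (circleRestrict 1 (κ·κ_p))` of its statement).

## Content (RH-FREE)

* `memLp_circleRestrict_kappaArch_mul_kappaPrime` — `κκ_p|_{S¹} ∈ L^∞`, unimodular, and the a.e. class
  of the vector `toLpOrZero ∞ (κκ_p|S¹)`.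
* `fourierCoeff_congr_ae`, `eq_of_inner_fourierLp_eq` — bookkeeping (Fourier coefficients of an a.e.
  class; vectors with equal Fourier coefficients are equal), public versions of the helpers of
  `QuasiInnerPrimeOffDiag.lean`.
* `inner_fourierLp_negSucc_hardyOffDiag_kappaProduct` — `⟨e_{−k−1} | (1 − 𝒫)κκ_p𝒫 e_b⟩ =
  (κκ_p)^(−k−b−1)` (`b ≥ 0`).
* `hasDerivAt_cayleyInv`, `hasDerivAt_cayleyKernel_zero`, `deriv_cayleyKernel_zero` — `ψ⁻¹′(z) =
  −8/(2z−3)²`, and `R_j′(0) = j·x₀^{j−1}·(64/81) + x₀^j·(−32/27)`, `x₀ = ψ⁻¹(0) = −1/3` (the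
  `k`-dependence «`αx^{k−1} + (k−1)βx^{k−1}`, `x = −1/3`» of the residue at the double pole).

Nothing in this file bears on the truth of RH.
-/

noncomputable section

open _root_.MeasureTheory _root_.Complex AddCircle Filter Set
open scoped Real ENNReal Topology InnerProductSpace ComplexConjugate

namespace Literature.NumberTheory.ConnesConsani2021

namespace QuasiInner

/-! ### The symbol `κκ_p|_{S¹}` -/

/-- **`κκ_p|_{S¹} ∈ L^∞(S¹)` is unimodular**, and the vector `toLpOrZero ∞ (κκ_p|S¹)` of the typed
Theorem 4.4 (ii) is (the class of) this function («`u(z) = ρ_∞(z)ρ_p(z)` … of modulus one on the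
critical line»). [cite: ConnesConsani2021QuasiInner, Thm 4.4 (arXiv chunk p0011:L89–L92) with §1 Definition (p0003:L5)] -/
theorem memLp_circleRestrict_kappaArch_mul_kappaPrime {p : ℕ} (hp : 1 < p) :
    MemLp (circleRestrict 1 fun v => kappaArch v * kappaPrime p v) ∞ (haarAddCircle (T := 1)) ∧
    (∀ x : AddCircle (1 : ℝ), ‖circleRestrict 1 (fun v => kappaArch v * kappaPrime p v) x‖ = 1) ∧
    ((toLpOrZero ∞ haarAddCircle (circleRestrict 1 fun v => kappaArch v * kappaPrime p v) :
        Lp ℂ ∞ (haarAddCircle (T := 1))) : AddCircle (1 : ℝ) → ℂ) =ᵐ[haarAddCircle (T := 1)]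
      circleRestrict 1 fun v => kappaArch v * kappaPrime p v := by
  obtain ⟨hA, -, -⟩ := memLp_circleRestrict_kappaArch
  obtain ⟨hP, -, -⟩ := memLp_circleRestrict_kappaPrime hp
  have hprod : (circleRestrict 1 fun v => kappaArch v * kappaPrime p v) =
      fun x => circleRestrict 1 kappaArch x * circleRestrict 1 (kappaPrime p) x := by
    funext x; rfl
  have hnorm : ∀ x : AddCircle (1 : ℝ), ‖circleRestrict 1 (fun v => kappaArch v * kappaPrime p v) x‖ = 1 := by
    intro x
    rw [hprod]
    simp only [norm_mul, norm_circleRestrict_kappaArch 1 x, norm_circleRestrict_kappaPrime (T := 1) hp x,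
      mul_one]
  have hmem : MemLp (circleRestrict 1 fun v => kappaArch v * kappaPrime p v) ∞ (haarAddCircle (T := 1)) := by
    refine memLp_top_of_bound ?_ 1 (ae_of_all _ fun x => (hnorm x).le)
    rw [hprod]
    exact hA.aestronglyMeasurable.mul hP.aestronglyMeasurable
  refine ⟨hmem, hnorm, ?_⟩
  rw [toLpOrZero_eq_toLp hmem]
  exact MemLp.coeFn_toLp _

/-! ### Fourier bookkeeping -/

variable (T : ℝ) [hT : Fact (0 < T)] in
/-- Fourier coefficients only depend on the a.e. class («`u ∈ L^∞(∂Ω)`» is a class of functions).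
[cite: ConnesConsani2021QuasiInner, §1 Definition (arXiv chunk p0003:L5)] -/
theorem fourierCoeff_congr_ae {f g : AddCircle T → ℂ} (h : f =ᵐ[haarAddCircle (T := T)] g) (n : ℤ) :
    fourierCoeff (T := T) f n = fourierCoeff (T := T) g n := by
  simp only [fourierCoeff]
  exact integral_congr_ae (by filter_upwards [h] with x hx; simp only [hx])

variable (T : ℝ) [hT : Fact (0 < T)] in
/-- Two vectors of `L²(S¹)` with the same Fourier coefficients `⟨e_n | ·⟩` are equal (the modes form a
Hilbert basis). [cite: ConnesConsani2021QuasiInner, §1 Definition (arXiv chunk p0003:L5)] -/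
theorem eq_of_inner_fourierLp_eq {v w : Lp ℂ 2 (haarAddCircle (T := T))}
    (h : ∀ n : ℤ, ⟪fourierLp (T := T) 2 n, v⟫_ℂ = ⟪fourierLp (T := T) 2 n, w⟫_ℂ) : v = w := by
  apply (fourierBasis (T := T)).repr.injective
  ext n
  have e : ∀ u : Lp ℂ 2 (haarAddCircle (T := T)),
      (fourierBasis (T := T)).repr u n = ⟪fourierLp (T := T) 2 n, u⟫_ℂ := fun u => by
    rw [HilbertBasis.repr_apply_apply, coe_fourierBasis]
  rw [e, e, h n]

/-- **The matrix of `(1 − 𝒫)κκ_p𝒫`**, entries `(−k−1, b)`, `b ≥ 0`: `⟨e_{−k−1}|(1 − 𝒫)κκ_p𝒫 e_b⟩ =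
(κκ_p)^(−k−b−1)` («We compute the Fourier coefficients of the function `κ_{p,∞}` …»).
[cite: ConnesConsani2021QuasiInner, Thm 4.4 (ii) proof (arXiv chunk p0011:L100–L104)] -/
theorem inner_fourierLp_negSucc_hardyOffDiag_kappaProduct {p : ℕ} (hp : 1 < p) (k b : ℕ) :
    ⟪fourierLp (T := 1) 2 (-(k + 1 : ℤ)),
      hardyOffDiag 1 (toLpOrZero ∞ haarAddCircle (circleRestrict 1 fun v => kappaArch v * kappaPrime p v))
        (fourierLp (T := 1) 2 (b : ℤ))⟫_ℂ =
      fourierCoeff (T := 1) (circleRestrict 1 fun v => kappaArch v * kappaPrime p v)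
        (-((k + b : ℕ) + 1 : ℤ)) := by
  rw [inner_fourierLp_negSucc_hardyOffDiag_fourierLp_natCast,
    fourierCoeff_congr_ae 1 (memLp_circleRestrict_kappaArch_mul_kappaPrime hp).2.2]

/-! ### The kernel derivatives at the double pole `z = 0` -/

/-- `ψ⁻¹′(z) = −8/(2z − 3)²` («implementing the differential `dψ⁻¹(z) = −8(2z−3)⁻²dz`»).
[cite: ConnesConsani2021QuasiInner, §2 (arXiv chunk p0005:L38–L44)] -/
theorem hasDerivAt_cayleyInv {z : ℂ} (hz : (2 * z - 3 : ℂ) ≠ 0) :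
    HasDerivAt cayleyInv ((-8 : ℂ) / (2 * z - 3) ^ 2) z := by
  have h1 : HasDerivAt (fun w : ℂ => 2 * w + 1) 2 z := by
    simpa using ((hasDerivAt_id z).const_mul (2 : ℂ)).add_const (1 : ℂ)
  have h2 : HasDerivAt (fun w : ℂ => 2 * w - 3) 2 z := by
    simpa using ((hasDerivAt_id z).const_mul (2 : ℂ)).sub_const (3 : ℂ)
  have h := h1.div h2 hz
  have e : cayleyInv = fun w : ℂ => (2 * w + 1) / (2 * w - 3) := rfl
  rw [e]
  refine h.congr_deriv ?_
  rw [show (2 * (2 * z - 3) - (2 * z + 1) * 2 : ℂ) = -8 by ring]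

/-- The derivative of `(ψ⁻¹)′ = −8/(2z−3)²`: `32/(2z−3)³`. [cite: ConnesConsani2021QuasiInner, §2 (arXiv chunk p0005:L38–L44)] -/
theorem hasDerivAt_cayleyInvDeriv {z : ℂ} (hz : (2 * z - 3 : ℂ) ≠ 0) :
    HasDerivAt (fun w : ℂ => (-8 : ℂ) / (2 * w - 3) ^ 2) ((32 : ℂ) / (2 * z - 3) ^ 3) z := by
  have h2 : HasDerivAt (fun w : ℂ => 2 * w - 3) 2 z := by
    simpa using ((hasDerivAt_id z).const_mul (2 : ℂ)).sub_const (3 : ℂ)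
  have h3 : HasDerivAt (fun w : ℂ => (2 * w - 3) ^ 2) ((2 : ℕ) * (2 * z - 3) ^ (2 - 1) * 2) z :=
    h2.pow 2
  simp only [Nat.reduceSub, pow_one, Nat.cast_ofNat] at h3
  have h := (hasDerivAt_const z (-8 : ℂ)).div h3 (pow_ne_zero 2 hz)
  refine h.congr_deriv ?_
  rw [div_eq_div_iff (pow_ne_zero 2 (pow_ne_zero 2 hz)) (pow_ne_zero 3 hz)]
  ring

/-- **`R_j′(0)`**, `R_j = (ψ⁻¹)^j·(ψ⁻¹)′`: `R_j′(0) = j·ψ⁻¹(0)^{j−1}·ψ⁻¹′(0)² + ψ⁻¹(0)^j·(ψ⁻¹)″(0)` with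
`ψ⁻¹(0) = −1/3`, `ψ⁻¹′(0) = −8/9`, `(ψ⁻¹)″(0) = −32/27` — the `k`-dependence «`αx^{k−1} + (k−1)βx^{k−1}`,
`x = −1/3`» of the residue at the double pole.
[cite: ConnesConsani2021QuasiInner, Thm 4.4 (ii) proof (arXiv chunk p0012:L10–L18)] -/
theorem hasDerivAt_cayleyKernel_zero (j : ℕ) :
    HasDerivAt (fun z : ℂ => cayleyInv z ^ j * ((-8 : ℂ) / (2 * z - 3) ^ 2))
      ((j : ℂ) * cayleyInv 0 ^ (j - 1) * ((-8 : ℂ) / (2 * 0 - 3) ^ 2) * ((-8 : ℂ) / (2 * 0 - 3) ^ 2) +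
        cayleyInv 0 ^ j * ((32 : ℂ) / (2 * 0 - 3) ^ 3)) 0 := by
  have hz : (2 * (0 : ℂ) - 3) ≠ 0 := by norm_num
  have h1 : HasDerivAt (fun z : ℂ => cayleyInv z ^ j)
      ((j : ℕ) * cayleyInv 0 ^ (j - 1) * ((-8 : ℂ) / (2 * 0 - 3) ^ 2)) 0 :=
    (hasDerivAt_cayleyInv hz).pow j
  exact h1.mul (hasDerivAt_cayleyInvDeriv hz)

/-- `R_j(0) = (−1/3)^j·(−8/9)` and `R_j′(0) = j(−1/3)^{j−1}(64/81) − (32/27)(−1/3)^j`, numerically.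
[cite: ConnesConsani2021QuasiInner, Thm 4.4 (ii) proof (arXiv chunk p0012:L10–L18)] -/
theorem deriv_cayleyKernel_zero (j : ℕ) :
    cayleyInv 0 = -1 / 3 ∧
    (cayleyInv 0 ^ j * ((-8 : ℂ) / (2 * 0 - 3) ^ 2) = (-1 / 3 : ℂ) ^ j * (-8 / 9)) ∧
    deriv (fun z : ℂ => cayleyInv z ^ j * ((-8 : ℂ) / (2 * z - 3) ^ 2)) 0 =
      (j : ℂ) * (-1 / 3 : ℂ) ^ (j - 1) * (64 / 81) + (-1 / 3 : ℂ) ^ j * (-32 / 27) := by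
  have h0 : cayleyInv 0 = -1 / 3 := by norm_num [cayleyInv]
  refine ⟨h0, by rw [h0]; norm_num, ?_⟩
  rw [(hasDerivAt_cayleyKernel_zero j).deriv, h0]
  norm_num
  ring

end QuasiInner

end Literature.NumberTheory.ConnesConsani2021

end
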